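import Literature.MathematicalPhysics.QuantumFieldTheory.Balaban1983to89.B8Ineq159FlatCubeMemberPrinted
import Literature.MathematicalPhysics.QuantumFieldTheory.Balaban1983to89.Node00.CarriersB8CubeDented

/-!
# `Balaban1983to89.B8Ineq159FlatDentedCubeMemberPrinted` — [Balaban1985RegularSpaces] (1.59) p. 86 ∕ (1.31) p. 82 ∕ [Balaban1984PropagatorsII] (2.3) p. 224 READ ON THE
# DENTED CUBE TOWER OF [Balaban1985Variational] (148)–(150): PRINT'S CONSTRAINT-BOND CLASS `CubeB8D.lamBP` AND THE NAMED FACT «(1.59) at `U₀ = 1` on the dented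
# cube member» (`Ineq159FlatDentedCubeMemberPrinted`) — the (1.59)♭ TARGET of the (β) road, piece (d2-a)

statement-level skeleton of published theorems with citation tags; proofs where landed; nothing here is a claim about the
Yang–Mills mass gap

`[Balaban1985RegularSpaces]` ("B8" = [6], CMP **99** (1985) 75–102) (1.31) p. 82, (1.58)–(1.59) p. 86, (1.62) p. 87, (1.131)–(1.132) p. 99, p. 98, (1.3)–(1.4) p. 77;
`[Balaban1984PropagatorsII]` ("B6", CMP **96** (1984) 223–250) (2.3) p. 224 («Λ_j = Ω_j^{(j)} ∖ Ω_{j+1}^{(j)} … for the sets of sites and the sets of bonds»; bonds of `Ω` =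
«at least one end-point of b belongs to Ω»); `[Balaban1985Variational]` ("[15]", CMP **102** (1985) 277–309) p. 300 («a cube □ intersecting Ω_j but not Ω_{j+1}»),
(148)–(150) p. 301 («Ω′_j = □_j, j = 0, 1, …, k − 1»; the top member cut back to `□_k ∩ Ω_k`), (152)–(153) p. 301; [4] = `[Balaban1985BackgroundPropagators]` (CMP **99**
(1985) 389–434) Thm 3.3 p. 399.  PDF held: `paper:balaban1985-cmp99-regular-spaces-gauge-fixing`, `paper:balaban1985-cmp102-variational-background` (pp. 24–25 = journal
pp. 300–301), `paper:balaban1984-cmp96-propagators-rt-ii`.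

CITATION HEADER (lean-in-tree rule).  Cell `pub-ymgap` (YM Track A, HUMAN RULING D-0062), DAG node N05 = [B8], seat `pub-ymgap-dag-n05-e` (g31; FAN-OUT §N05 row s3b,
Proposition-6 lane; piece (d2-a) of the (β) road: this seat WORD (β) I.41343, dag-n05-c PRICE I.41357 (2) «(d2) also needs a dented (1.59)♭ TARGET `def` … keyed on
(d1)'s letters», GO I.42243).  WHY THIS FILE.  dag-n05-c's `B8Ineq159FlatCubeMemberPrinted.Ineq159FlatCubeMemberPrinted d L` states [6] (1.59) at the flat background
`U₀ = 1` on the PURE cube member `{□_j}` of (1.131) (averaging datum over print's class `cubeLamBP`, Dirichlet exterior, three members, print's p. 98 big-block sub-lattice)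
and is PROVED for odd `L ≥ 5` by the torus transplant (`B8Ineq159FlatCubeMemberTransplant.ineq159FlatCubeMemberPrinted_holds`); this seat's flat line consumes it
(`B8Ineq159FlatCubeMemberSCGamma` → `B8Prop6CubeMemberScalarGammaHolds`) to land [6] Proposition 6 as `Node00.GaugedBoundB8` at every pure cube.  [15] p. 300–301
needs Proposition 6's conclusion for «a cube □ intersecting Ω_k but not Ω_{k+1}» that may stick out of `Ω_k`, i.e. on the DENTED tower `{Ω′_j}` of (148)–(150) — NODE 00's
`Node00.CubeB8D` ∕ `CubeB8D.sq` ∕ `CubeB8D.lamS` ∕ `GaugedBoundB8D` (p655171).  At every truncation `m < k` the dented member's truncated tower IS the pure member's, so the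
pure named fact already serves; the ONE new statement is (1.59) at the TOP truncation `m = k` of the dented tower.  THIS FILE types (§1) print's constraint-bond class on the
dented tower at that truncation, `CubeB8D.lamBP` ([B6] (2.3): «at least one end-point in (Ω′_j)^{(j)}, no end-point inside (Ω′_{j+1})^{(j)}»; the comprehension of
`CubeB8D.lamS` with «the site» replaced by «an end of the bond»), and (§2) the named fact `Ineq159FlatDentedCubeMemberPrinted d L` = the matrix of dag-n05-c's
`Ineq159FlatCubeMemberPrinted` VERBATIM at `m = k` with `cubeFam false L a M ρ k ↦ c.sq`, `cubeLamS … k ↦ c.lamS`, `cubeLamBP … k ↦ c.lamBP`, quantified over the dented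
data `c : CubeB8D d L K Ω`, the seven sub-lattice side conditions on `c.M, c.ρ` verbatim, PLUS the one premise the dent costs: «`Ω_k` is a union of cubes of side
`L^{s+1}·Lᵏ` (= `M₁Lᵏ` fine sites, `M₁ = L^{s+1} = M_hL`) of the grid anchored at `□_k`'s fine lower corner `Lᵏ(c.a − c.ρ)`» ([6] (1.4)₂ «Ω_j is a sum of cubes of a size
M₁Lʲη» on the grid that carries `□_k`, p. 98 «□_j is a sum of the big blocks of the lattice T_{L^{−j}}»; [15] p. 300 relies on exactly this to average over `□_k ∩ Ω_k`) —
the statement the dented transplant ((d2-c), dag-n05-c's lineage, on `B8CubeMemberTorusDomainsDented.cubeTDomainsDented`) delivers and this seat's (d3) γ re-assembly over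
`CubeB8D` consumes.

WHAT THIS FILE TYPES (definitions WITH BODY + `rfl`∕set bookkeeping; ONE named published fact as `def … : Prop`, NOT proved here).
* §1 **`CubeB8D.lamBP c j`** — print's class of level-`j` averaging bonds of the dented tower (top truncation): `j ≤ k`, at least one end `z ∈ {b₋, b₋ + e_κ}` with
  `z ∈ (Ω′_j)^{(j)}` (= `□_j^{(j)}` for `j < k`, = the `k`-sites of `□_k^{(k)}` whose block lies in `Ω_k` at `j = k`), and for `j < k` NO end inside `(Ω′_{j+1})^{(j)}`
  (= `□_{j+1}^{(j)}` for `j + 1 < k`, = the `(k−1)`-sites of `□_k^{(k−1)}` whose block lies in `Ω_k` at `j + 1 = k` — so the bonds over the dent `□_k ∖ Ω_k` are level-`(k−1)`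
  members, as the dent's sites are level-`(k−1)` cells); `mem_lamBP_iff` (`Iff.rfl`), `lamBP_of_add_two_le` (below the dent the class IS dag-n05-c's `cubeLamBP … k j`),
  `mem_lamBP_pred_iff` (`j = k − 1`), `mem_lamBP_top_iff` (`j = k`), `lamBP_of_gt` (empty above `k`), `fst_or_snd_mem_lamS_of_mem_lamBP`-type reading `ends_of_mem_lamBP`
  (an end of a class bond is a CELL of the dented tower: `∈ c.lamS j`).
* §2 **`Ineq159FlatDentedCubeMemberPrinted d L : Prop`** — the named fact, as described.
HONEST SCOPE.  Definitions + bookkeeping + ONE named published fact ([6] (1.59) ∕ [4] Thm 3.3 at `U = 1`, Dirichlet exterior, on the dented member — OPEN in the tree: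
its proof is the dented transplant (d2-b)∕(d2-c), not this file); nothing of Bałaban's analysis asserted as a theorem; count-neutral; N05 ∕ N07 NOT discharged; one
finite `T⁴` programme at fixed `ε`, Bałaban as printed; nothing continuum ∕ ℝ⁴ ∕ OS ∕ mass-gap ∕ Clay.  No `sorry`, no `instance`, no `notation`.  Unit `pub-ymgap-dag-n05-e`
(g31), 2026-08-28.

RELATED IN THE TREE, NOT DUPLICATED (`rg` 2026-08-28T19:30Z: `ls Balaban1983to89 | grep -ci 'FlatDentedCubeMember'` = 0): `B8Ineq159FlatCubeMemberPrinted.cubeLamBP` ∕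
`Ineq159FlatCubeMemberPrinted` (dag-n05-c p573921; the PURE class ∕ fact — USED as the model, `lamBP_of_add_two_le` identifies the two classes below the dent),
`Node00.CubeB8D` ∕ `.sq` ∕ `.lamS` ∕ `.inTop` (p655171; USED, not re-declared), `B8CubeMemberTorusDomainsDented` (this seat g31, the torus-side member; independent of this
file), `B8Eq134Admissible.BigCubes14` (NODE 00's standard-grid form of (1.4)₂; the anchored premise here is its reading on `□_k`'s grid —
`B8CubeMemberTorusDomainsDented.anchored_of_bigCubes14`).
-/

noncomputable section

namespace Literature.MathematicalPhysics.QuantumFieldTheory.Balaban1983to89.B8Ineq159FlatDentedCubeMemberPrinted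

open B7Prop1Explicit B7Prop2Explicit B7Prop1Local
open B7Prop4GeneralLevels (linCovIter)
open B8Ineq132 (covDerivFwd BondTouches Under)
open B8Eq140Level (SideTouches)
open B8Eq146AExpansion (iEta)
open B8Eq155JBound (Jcur)
open B8Eq138LandauZd (IsLandau138 covLap)
open B8Eq131Cubes (cube sqLo sqHi inLo inHi)
open B8Ineq159FlatCubeMemberPrinted (cubeLamBP)
open Node00 (CubeB8D)
open Literature.MathematicalPhysics.QuantumLattice (blockMap)

variable {d : ℕ}

/-! ## §1 Print's constraint-bond class on the dented tower (top truncation) -/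

section Class

variable {L K : ℕ} {Ω : ℕ → Set (B7Prop1Explicit.Site d)}

/-- **PRINT'S CONSTRAINT-BOND CLASS AT LEVEL `j` OF THE DENTED TOWER `{Ω′_j}`** (top truncation `m = k`; [B6] (2.3) for bonds, [6] (1.31)'s contours, read on [15]'s local
sequence (148)–(150)): a level-`j` bond `b = ⟨b₋, b₋ + e_κ⟩`, `j ≤ k`, with AT LEAST ONE end in `(Ω′_j)^{(j)}` — `□_j^{(j)}` for `j < k`, the `k`-sites of `□_k^{(k)}` whose
`k`-block lies in `Ω_k` at `j = k` — and, when `j < k`, NO end inside `(Ω′_{j+1})^{(j)}` — `□_{j+1}^{(j)}` for `j + 1 < k`, the `(k−1)`-sites of `□_k^{(k−1)}` whose block lies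
in `Ω_k` at `j + 1 = k`.  ONE comprehension, the guards `j = k`, `j + 1 = k` doing the case split — the comprehension of `CubeB8D.lamS` (p655171) with «the site» replaced
by «an end of the bond»; dag-n05-c's `cubeLamBP L a M ρ k k j` when the dent is empty or `j + 2 ≤ k`.
[cite: Balaban1984PropagatorsII, (2.3) p.224; Balaban1985RegularSpaces, (1.31) p.82, (1.131) p.99; Balaban1985Variational, (148)–(150) p.301] -/
def _root_.Literature.MathematicalPhysics.QuantumFieldTheory.Balaban1983to89.Node00.CubeB8D.lamBP (c : CubeB8D d L K Ω) (j : ℕ) : Set (B7Prop1Explicit.Site d × Fin d) :=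
  {b | j ≤ c.k ∧
    ((InBox (sqLo L c.a c.ρ c.k j) (sqHi L c.a c.M c.ρ c.k j) b.1 ∧ (j = c.k → ∀ x, Under L j b.1 x → x ∈ Ω c.k)) ∨
      (InBox (sqLo L c.a c.ρ c.k j) (sqHi L c.a c.M c.ρ c.k j) (b.1 + e b.2) ∧ (j = c.k → ∀ x, Under L j (b.1 + e b.2) x → x ∈ Ω c.k))) ∧
    (j < c.k →
      ¬ (InBox (inLo L c.a c.ρ c.k j) (inHi L c.a c.M c.ρ c.k j) b.1 ∧ (j + 1 = c.k → ∀ x, Under L j b.1 x → x ∈ Ω c.k)) ∧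
      ¬ (InBox (inLo L c.a c.ρ c.k j) (inHi L c.a c.M c.ρ c.k j) (b.1 + e b.2) ∧ (j + 1 = c.k → ∀ x, Under L j (b.1 + e b.2) x → x ∈ Ω c.k)))}

variable (c : CubeB8D d L K Ω)

/-- Membership, unfolded (`Iff.rfl`). [cite: Balaban1984PropagatorsII, (2.3) p.224; Balaban1985Variational, (148)–(150) p.301] -/
theorem mem_lamBP_iff (j : ℕ) (b : B7Prop1Explicit.Site d × Fin d) :
    b ∈ c.lamBP j ↔ j ≤ c.k ∧
      ((InBox (sqLo L c.a c.ρ c.k j) (sqHi L c.a c.M c.ρ c.k j) b.1 ∧ (j = c.k → ∀ x, Under L j b.1 x → x ∈ Ω c.k)) ∨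
        (InBox (sqLo L c.a c.ρ c.k j) (sqHi L c.a c.M c.ρ c.k j) (b.1 + e b.2) ∧ (j = c.k → ∀ x, Under L j (b.1 + e b.2) x → x ∈ Ω c.k))) ∧
      (j < c.k →
        ¬ (InBox (inLo L c.a c.ρ c.k j) (inHi L c.a c.M c.ρ c.k j) b.1 ∧ (j + 1 = c.k → ∀ x, Under L j b.1 x → x ∈ Ω c.k)) ∧
        ¬ (InBox (inLo L c.a c.ρ c.k j) (inHi L c.a c.M c.ρ c.k j) (b.1 + e b.2) ∧ (j + 1 = c.k → ∀ x, Under L j (b.1 + e b.2) x → x ∈ Ω c.k))) :=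
  Iff.rfl

/-- **BELOW THE DENT THE CLASS IS [6]'s**: for `j + 2 ≤ k` (neither `Ω′_j` nor `Ω′_{j+1}` is the cut top member) `c.lamBP j` is dag-n05-c's `cubeLamBP L c.a c.M c.ρ c.k c.k j`
(pure member, top truncation). [cite: Balaban1985Variational, (150) p.301 («Ω′_j = □_j, j = 0, 1, …, k − 1»); Balaban1984PropagatorsII, (2.3) p.224; Balaban1985RegularSpaces, (1.131) p.99] -/
theorem lamBP_of_add_two_le {j : ℕ} (hj : j + 2 ≤ c.k) : c.lamBP j = cubeLamBP L c.a c.M c.ρ c.k c.k j := by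
  ext b
  have h1 : j ≤ c.k := by omega
  have h2 : j ≠ c.k := by omega
  have h3 : j + 1 ≠ c.k := by omega
  have h4 : j < c.k := by omega
  simp only [mem_lamBP_iff, B8Ineq159FlatCubeMemberPrinted.mem_cubeLamBP_iff, h1, h2, h3, h4, IsEmpty.forall_iff, and_true, forall_const, true_and]

/-- **THE LEVEL-`(k−1)` CLASS**: bonds with an end in `□_{k−1}^{(k−1)}` and no end whose `(k−1)`-block lies in `Ω′_k = □_k ∩ Ω_k` — [6]'s level-`(k−1)` class ENLARGED by
the bonds over the dent (`k ≥ 1`; for `k = 1` this is level `0`). [cite: Balaban1985Variational, (148)–(150) p.301; Balaban1984PropagatorsII, (2.3) p.224] -/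
theorem mem_lamBP_pred_iff (b : B7Prop1Explicit.Site d × Fin d) :
    b ∈ c.lamBP (c.k - 1) ↔
      (InBox (sqLo L c.a c.ρ c.k (c.k - 1)) (sqHi L c.a c.M c.ρ c.k (c.k - 1)) b.1 ∨
        InBox (sqLo L c.a c.ρ c.k (c.k - 1)) (sqHi L c.a c.M c.ρ c.k (c.k - 1)) (b.1 + e b.2)) ∧
      ¬ (InBox (inLo L c.a c.ρ c.k (c.k - 1)) (inHi L c.a c.M c.ρ c.k (c.k - 1)) b.1 ∧ ∀ x, Under L (c.k - 1) b.1 x → x ∈ Ω c.k) ∧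
      ¬ (InBox (inLo L c.a c.ρ c.k (c.k - 1)) (inHi L c.a c.M c.ρ c.k (c.k - 1)) (b.1 + e b.2) ∧ ∀ x, Under L (c.k - 1) (b.1 + e b.2) x → x ∈ Ω c.k) := by
  have hk := c.one_le_k
  have h1 : c.k - 1 ≤ c.k := Nat.sub_le _ _
  have h2 : c.k - 1 ≠ c.k := by omega
  have h3 : c.k - 1 + 1 = c.k := by omega
  have h4 : c.k - 1 < c.k := by omega
  simp only [mem_lamBP_iff, h1, h2, h3, h4, IsEmpty.forall_iff, and_true, forall_const, true_and]

/-- **THE LEVEL-`k` CLASS**: bonds of `□_k^{(k)}` with at least one end whose `k`-block lies in `Ω_k` (an end in `(Ω′_k)^{(k)} = Λ′_k`), no deepness condition at the top.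
[cite: Balaban1985Variational, (148) p.301; Balaban1984PropagatorsII, (2.3) p.224; Balaban1985RegularSpaces, (1.131) p.99 («Λ′_k = □_k^{(k)}»)] -/
theorem mem_lamBP_top_iff (b : B7Prop1Explicit.Site d × Fin d) :
    b ∈ c.lamBP c.k ↔
      (InBox (sqLo L c.a c.ρ c.k c.k) (sqHi L c.a c.M c.ρ c.k c.k) b.1 ∧ c.inTop b.1) ∨
        (InBox (sqLo L c.a c.ρ c.k c.k) (sqHi L c.a c.M c.ρ c.k c.k) (b.1 + e b.2) ∧ c.inTop (b.1 + e b.2)) := by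
  simp only [mem_lamBP_iff, le_refl, lt_irrefl, IsEmpty.forall_iff, and_true, forall_const, true_and, Node00.CubeB8D.inTop]

/-- No class above `k` (the tower has `k + 1` members). [cite: Balaban1985Variational, (150) p.301 (dictionary); Balaban1984PropagatorsII, (2.3) p.224] -/
theorem lamBP_of_gt {j : ℕ} (hj : c.k < j) : c.lamBP j = ∅ := by
  ext b
  have : ¬ j ≤ c.k := by omega
  simp only [mem_lamBP_iff, this, false_and, Set.mem_empty_iff_false]

/-- **AN END OF A CLASS BOND IS A CELL OF THE DENTED TOWER**: if `b ∈ c.lamBP j` then `b₋ ∈ Λ′_j` or `b₋ + e_κ ∈ Λ′_j` (`CubeB8D.lamS`, p655171) — the end lying in `(Ω′_j)^{(j)}`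
is not deep, by the class's own exclusion. [cite: Balaban1984PropagatorsII, (2.3) p.224 («Λ_j … for the sets of sites and the sets of bonds»); Balaban1985Variational, (148) p.301] -/
theorem ends_of_mem_lamBP {j : ℕ} {b : B7Prop1Explicit.Site d × Fin d} (hb : b ∈ c.lamBP j) : b.1 ∈ c.lamS j ∨ b.1 + e b.2 ∈ c.lamS j := by
  obtain ⟨hjk, hends, hdeep⟩ := hb
  have hl : ∀ z : B7Prop1Explicit.Site d, (InBox (sqLo L c.a c.ρ c.k j) (sqHi L c.a c.M c.ρ c.k j) z ∧ (j = c.k → ∀ x, Under L j z x → x ∈ Ω c.k)) →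
      (j < c.k → ¬ (InBox (inLo L c.a c.ρ c.k j) (inHi L c.a c.M c.ρ c.k j) z ∧ (j + 1 = c.k → ∀ x, Under L j z x → x ∈ Ω c.k))) →
      z ∈ c.lamS j := by
    intro z hz hnd
    simp only [Node00.CubeB8D.lamS, if_pos hjk]
    exact ⟨hz.1, hz.2, hnd⟩
  rcases hends with h | h
  · exact Or.inl (hl _ h fun hj => (hdeep hj).1)
  · exact Or.inr (hl _ h fun hj => (hdeep hj).2)

end Class

/-! ## §2 The named fact: (1.59) at `U₀ = 1` on the dented cube member, top truncation -/

/-- **[Balaban1985RegularSpaces] (1.59) AT THE FLAT BACKGROUND `U₀ = 1` ON THE DENTED CUBE TOWER `{Ω′_j}` OF [Balaban1985Variational] (148)–(150), TOP TRUNCATION,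
AVERAGING DATUM OVER PRINT'S CLASS** (= [Balaban1985BackgroundPropagators] Thm 3.3 at `U = 1` with Dirichlet exterior on `□₀`, for the sequence `Ω′₀ = □₀ ⊃ … ⊃ Ω′_{k−1} =
□_{k−1} ⊃ Ω′_k = □_k ∩ Ω_k`): there are `B₀ > 0` and thresholds `ρ₀, M₀, N₀, R₀` (functions of `d, L`) such that for every `η > 0`, every ambient family `{Ω_j}_{j ≤ K}`, every
dented cube datum `c : CubeB8D d L K Ω` on print's p. 98 big-block sub-lattice (`M_h = Lˢ`: `M₀ ≤ L^{s+1}`, `L^{s+1} ∣ c.ρ`, `L^{s+1} ∣ c.M`, `R·L^{s+1} ≤ c.ρ`, `R₀ ≤ R`,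
`N₀ + 1 ≤ R·L^{s+1}`, `ρ₀ ≤ c.ρ` — print's «R₁, M₁ the smallest integers for which all the theorems of [2, 4] are valid», «M a multiple of R₁M₁») whose ambient top member `Ω_k`
IS A UNION OF CUBES OF SIDE `M₁Lᵏ = L^{s+1}·Lᵏ` OF THE GRID ANCHORED AT `□_k`'s FINE LOWER CORNER `Lᵏ(c.a − c.ρ)` ((1.4)₂ «Ω_j is a sum of cubes of a size M₁Lʲη» on the
grid carrying `□_k`; [15] p. 300), and every ℂ-valued bond function `φ` in the flat Landau gauge (1.38) for the dented tower (`Ω′₀ = c.sq 0 = □₀`, cells `c.lamS`): if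
`N ≥ 0` bounds (i) `(Lʲη)³|J(φ)|` on the bonds of `Ω′_j`, (ii) the un-normalised flat averages `|Lʲη·Q_j(iηφ)(b)|` on EVERY bond `b` of PRINT'S class `c.lamBP j`, and (iii)
`η|φ|` on the outer layer (bonds with no end in `□₀`), then on every bond side-touching `Ω′_j`: `(Lʲη)|φ| ≤ B₀N`, `(Lʲη)²|D^η_{1,ν}φ_τ| ≤ B₀N` (all `ν`), `(Lʲη)³|Δ^η_1φ_τ| ≤
B₀N` — print's «|A|₍₋₁₎, |∇^η_{U₀}A|₍₋₂₎, |Δ^η_{U₀}A|₍₋₃₎ ≦ B₀(|J|₍₋₃₎ + |B₁|)» at `U₀ = 1` in the pointwise form «on Ω′_j» ((1.62) ∕ (152)).  The matrix of dag-n05-c's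
`Ineq159FlatCubeMemberPrinted` at `m = k` with `cubeFam false ↦ c.sq`, `cubeLamS … k ↦ c.lamS`, `cubeLamBP … k ↦ c.lamBP`, plus the anchored dent premise.  Named, NOT proved
here; the target of the dented torus transplant (on `B8CubeMemberTorusDomainsDented.cubeTDomainsDented`).  The lower truncations `m < k` of the dented member are the
pure member's and are served by `Ineq159FlatCubeMemberPrinted` itself.
[cite: Balaban1985RegularSpaces, (1.59) p.86, (1.62) p.87, (1.31) p.82, (1.38) p.82, (1.131)–(1.132) p.99, p.98, (1.4) p.77; Balaban1985Variational, (148)–(150) p.301, (152) p.301, p.300; Balaban1985BackgroundPropagators, Thm 3.3 p.399, (3.47) p.398; Balaban1984PropagatorsII, Prop. 2.6 (2.136) p.247, (2.3) p.224] -/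
def Ineq159FlatDentedCubeMemberPrinted (d L : ℕ) : Prop :=
  ∃ B₀ ρ₀ M₀ : ℝ, ∃ N₀ R₀ : ℕ, 0 < B₀ ∧
    ∀ (η : ℝ), 0 < η → ∀ (K : ℕ) (Ω : ℕ → Set (B7Prop1Explicit.Site d)) (c : CubeB8D d L K Ω) (s R : ℕ),
      M₀ ≤ (L : ℝ) ^ (s + 1) → L ^ (s + 1) ∣ c.ρ → L ^ (s + 1) ∣ c.M → R * L ^ (s + 1) ≤ c.ρ → R₀ ≤ R →
      N₀ + 1 ≤ R * L ^ (s + 1) → ρ₀ ≤ (c.ρ : ℝ) →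
      (∀ x y : B7Prop1Explicit.Site d,
          blockMap (L ^ (s + 1) * L ^ c.k) (x - fun i => (L : ℤ) ^ c.k * (c.a i - c.ρ)) =
            blockMap (L ^ (s + 1) * L ^ c.k) (y - fun i => (L : ℤ) ^ c.k * (c.a i - c.ρ)) → x ∈ Ω c.k → y ∈ Ω c.k) →
      ∀ φ : B7Prop1Explicit.Site d → Fin d → ℂ,
        IsLandau138 L c.k η (c.sq 0) c.lamS (1 : B7Prop1Explicit.Site d → Fin d → ℂˣ) φ →
        (∀ (y : B7Prop1Explicit.Site d) (τ : Fin d), (∀ j, j ≤ c.k → ¬ SideTouches (c.sq j) y τ) → φ y τ = 0) →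
        ∀ N : ℝ, 0 ≤ N →
          (∀ j, j ≤ c.k → ∀ (y : B7Prop1Explicit.Site d) (τ : Fin d), BondTouches (c.sq j) y τ →
              ((L : ℝ) ^ j * η) ^ 3 * ‖Jcur η (1 : B7Prop1Explicit.Site d → Fin d → ℂˣ) φ τ y‖ ≤ N) →
          (∀ j, j ≤ c.k → ∀ b ∈ c.lamBP j,
              ‖linCovIter L (1 : B7Prop1Explicit.Site d → Fin d → ℂˣ) (iEta η φ) j b.1 b.2‖ ≤ N) →
          (∀ (y : B7Prop1Explicit.Site d) (τ : Fin d), ¬ BondTouches (c.sq 0) y τ → η * ‖φ y τ‖ ≤ N) →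
          ∀ j, j ≤ c.k → ∀ (y : B7Prop1Explicit.Site d) (τ : Fin d), SideTouches (c.sq j) y τ →
            ((L : ℝ) ^ j * η) * ‖φ y τ‖ ≤ B₀ * N ∧
            (∀ ν : Fin d, ((L : ℝ) ^ j * η) ^ 2 * ‖covDerivFwd η (1 : B7Prop1Explicit.Site d → Fin d → ℂˣ) ν (fun z => φ z τ) y‖ ≤ B₀ * N) ∧
            ((L : ℝ) ^ j * η) ^ 3 * ‖covLap η (1 : B7Prop1Explicit.Site d → Fin d → ℂˣ) (fun z => φ z τ) y‖ ≤ B₀ * N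

end Literature.MathematicalPhysics.QuantumFieldTheory.Balaban1983to89.B8Ineq159FlatDentedCubeMemberPrinted

end
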